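import Mathlib
import Literature.Analysis.FluidPDE.SelfSimilar
import Literature.Analysis.FluidPDE.BlowupAncientSolutionProofs
import Literature.Analysis.FluidPDE.KNSSLiouvilleBridge
import HarnessLib

/-!
# Crux `PoloidalLiouville` (stmt-NavierStokesRegularity-1222, W1), crux idea «silent-shells» (ns-idea-15 g8):
# ingredient (I1) `SliceAnalytic` is FALSE AS TYPED (negative edge; the class sees slices only almost everywhere)

The sketch `Cruxes/PoloidalLiouville/SilentShellsSketch.lean` (v1.3, l.≈510) types I1 as

`SliceAnalytic : ∀ v, IsBoundedAncientMildSolution 1 v → (∀ t < 0, AEStronglyMeasurable (v t) volume) → ∀ t < 0, AnalyticOnNhd ℝ (v t) univ`.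

The duality class `IsBoundedAncientMildSolution` is insensitive to null-set modifications of the slices
(`IsBoundedAncientMildSolution.congr_ae_slice`), so the POINTWISE conclusion cannot hold: modify the zero solution at one point.
WITNESS: `v t x = if x = 0 then e₀ else 0` is in the class (a.e. equal to the constant solution `0`, bounded), has measurable
slices, and no slice is continuous at the origin, let alone analytic.  REPAIR (for the custodian): add the trigger's own regularity
binder `ContDiffOn ℝ ⊤ (uncurry v) (Iio 0 ×ˢ univ)` (or conclude analyticity of the continuous representative); the witness is not
continuous, so it misses the repaired statement.  This is bookkeeping about the typing, exactly parallel to the critic's V23 finding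
for I2; it says nothing about Lemarié-Rieusset's theorem (tree: `lemarieRieusset2016_local_analyticity_holds`), and NS regularity is
NOT proved or refuted by any of this.
-/

-- the summit and its single problem share the name (D-0017 nested layout)
set_option linter.dupNamespace false

noncomputable section

namespace Summit.NavierStokesRegularity.NavierStokesRegularity.Theorems.PoloidalLiouville.SilentShells

open Set Function Filter Topology Metric MeasureTheory
open scoped Topology
open Literature.Analysis.FluidPDE

/-- **(I1) `SliceAnalytic` is false as typed** (body of the sketch Prop negated, verbatim): the bounded ancient mild class does not
see null sets, so a one-point modification of the zero solution is a member with measurable, non-analytic slices. -/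
theorem sliceAnalytic_false_as_typed :
    ¬ (∀ v : ℝ → EuclideanSpace ℝ (Fin 3) → EuclideanSpace ℝ (Fin 3), IsBoundedAncientMildSolution 1 v →
        (∀ t < 0, AEStronglyMeasurable (v t) volume) → ∀ t < 0, AnalyticOnNhd ℝ (v t) univ) := by
  intro h
  set e₀ : EuclideanSpace ℝ (Fin 3) := EuclideanSpace.single 0 (1 : ℝ) with he₀
  have he₀ne : e₀ ≠ 0 := by
    intro h0
    have h1 := congrArg (fun v : EuclideanSpace ℝ (Fin 3) => v 0) h0
    simp [he₀] at h1
  -- the witness: the zero solution modified at the origin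
  set w : ℝ → EuclideanSpace ℝ (Fin 3) → EuclideanSpace ℝ (Fin 3) := fun _ x => if x = 0 then e₀ else 0 with hw
  have hae : ∀ t : ℝ, t < 0 → w t =ᵐ[volume] (fun _ _ => (0 : EuclideanSpace ℝ (Fin 3))) t := by
    intro t _
    have hnull : (volume : Measure (EuclideanSpace ℝ (Fin 3))) {0} = 0 := measure_singleton 0
    filter_upwards [compl_mem_ae_iff.mpr hnull] with x hx
    have hx' : x ≠ 0 := fun h0 => hx (by simp [h0])
    simp [hw, hx']
  have hbdd : IsBoundedOn (Iio 0) w := by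
    refine ⟨‖e₀‖, fun t _ x => ?_⟩
    by_cases hx : x = 0
    · simp [hw, hx]
    · simp [hw, hx]
  have hclass : IsBoundedAncientMildSolution 1 w :=
    (isBoundedAncientMildSolution_fun_const (E := EuclideanSpace ℝ (Fin 3)) 1 0).congr_ae_slice hae hbdd
  have hmeas : ∀ t < 0, AEStronglyMeasurable (w t) volume := fun t ht =>
    (aestronglyMeasurable_const (b := (0 : EuclideanSpace ℝ (Fin 3)))).congr (hae t ht).symm
  -- analyticity at `t = -1` would make the slice continuous at the origin
  have han := h w hclass hmeas (-1) (by norm_num)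
  have hcont : ContinuousAt (w (-1)) 0 := (han 0 (mem_univ _)).continuousAt
  have hlim : Tendsto (fun r : ℝ => w (-1) (r • e₀)) (𝓝[≠] 0) (𝓝 (w (-1) 0)) := by
    have hc : Tendsto (fun r : ℝ => r • e₀) (𝓝[≠] (0 : ℝ)) (𝓝 (0 : EuclideanSpace ℝ (Fin 3))) := by
      have h1 : Continuous fun r : ℝ => r • e₀ := continuous_id.smul continuous_const
      have h2 := h1.tendsto 0
      simp only [zero_smul] at h2
      exact h2.mono_left nhdsWithin_le_nhds
    exact hcont.tendsto.comp hc
  have hlim0 : Tendsto (fun r : ℝ => w (-1) (r • e₀)) (𝓝[≠] 0) (𝓝 0) := by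
    refine tendsto_const_nhds.congr' (eventually_nhdsWithin_of_forall fun r hr => ?_)
    have hne : r • e₀ ≠ 0 := smul_ne_zero hr he₀ne
    simp [hw, hne]
  have heq : w (-1) 0 = 0 := tendsto_nhds_unique hlim hlim0
  simp [hw] at heq
  exact he₀ne heq

end Summit.NavierStokesRegularity.NavierStokesRegularity.Theorems.PoloidalLiouville.SilentShells

end
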